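import Summits.RiemannHypothesis.RiemannHypothesis.Theorems.TiltedLandingLaw421Seam03
import Summits.RiemannHypothesis.RiemannHypothesis.Theorems.TiltedLandingLaw421SuccessorCertificateFrozen

/-! # TiltedLandingLaw421 — descent seam, part 04
Token-identical port of the descent framework of `Cruxes/TiltedLandingLaw421/Lines/law421birthS.lean`
(seam canon ce03e18b) into flat Theorems modules, so that crux line files can import it instead of inlining it.
No new mathematics; no `sorry`; no route (Theses) imports — the tree statement is mirrored as `RhW07.Seam.Law421Statement`. -/

namespace RhIdea5.G17.W07C9.Helpers
open Set Complex
open Summit.RiemannHypothesis.RiemannHypothesis.Theorems.Splittings.JensenWindow (LocalA)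

/-- `descentSigS_of_budget_window` — seam of the TiltedLandingLaw421 descent framework, part 04 (token-identical port of `Cruxes/TiltedLandingLaw421/Lines/law421birthS.lean`; no new mathematics). -/
theorem descentSigS_of_budget_window (Iso : (ℂ → ℂ) → ℝ → ℝ → ℂ → Prop)
    (hB : BudgetSig Iso) (hW : WindowSig Iso) (hHer : AnalyticHereditySig) : DescentSigS := by
  intro η f x₀ s hmax R Hs B hE
  have hE' := hE
  obtain ⟨hdiff, hreal, hgrowth, hs, hsh, hhR, h3R, hHs, hstrip, hHsR, hpair, hcol, hhalf, hη0, hη1, hrem⟩ := hE'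
  obtain ⟨j, u, hj, hu, hnz, hzu, huim, hiso⟩ := hB η f x₀ s hmax R Hs B hE
  have hCj : InClass (iteratedDeriv j f) Hs := hHer f Hs j hHs ⟨hdiff, hreal, hgrowth, hstrip⟩ hnz
  obtain ⟨α, β, H, hα, hβ, hSW⟩ := hW _ Hs R u hCj hnz hzu huim hiso
  refine ⟨j, α, β, H, hj, ?_, ?_, hnz, hSW⟩
  · have h1 := (abs_le.1 hu).1
    linarith
  · have h2 := (abs_le.1 hu).2
    linarith

/-- `descentSigS_of_budget_OKBox` — seam of the TiltedLandingLaw421 descent framework, part 04 (token-identical port of `Cruxes/TiltedLandingLaw421/Lines/law421birthS.lean`; no new mathematics). -/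
theorem descentSigS_of_budget_OKBox (hSign : OffJensenSignSig) (hHer : AnalyticHereditySig)
    (hDom : InDiscDominanceSig) (hB : BudgetSig OKBox) : DescentSigS :=
  descentSigS_of_budget_window OKBox hB (windowSig_OKBox hSign hDom) hHer

/-- `normSq_sub_eq` — seam of the TiltedLandingLaw421 descent framework, part 04 (token-identical port of `Cruxes/TiltedLandingLaw421/Lines/law421birthS.lean`; no new mathematics). -/
lemma normSq_sub_eq (p u : ℂ) : Complex.normSq (p - u) = (p.re - u.re) ^ 2 + (p.im - u.im) ^ 2 := by
  rw [Complex.normSq_apply]; simp [sub_re, sub_im]; ring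

/-- `normSq_sub_conj_eq` — seam of the TiltedLandingLaw421 descent framework, part 04 (token-identical port of `Cruxes/TiltedLandingLaw421/Lines/law421birthS.lean`; no new mathematics). -/
lemma normSq_sub_conj_eq (p u : ℂ) :
    Complex.normSq (p - (starRingEnd ℂ) u) = (p.re - u.re) ^ 2 + (p.im + u.im) ^ 2 := by
  rw [Complex.normSq_apply]; simp [sub_re, sub_im, Complex.conj_re, Complex.conj_im]; ring

/-- `pairTermLanderBound_holds` — seam of the TiltedLandingLaw421 descent framework, part 04 (token-identical port of `Cruxes/TiltedLandingLaw421/Lines/law421birthS.lean`; no new mathematics). -/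
theorem pairTermLanderBound_holds : PairTermLanderBound := by
  intro m p u₀ hp hε hd
  unfold pairTerm
  rw [normSq_sub_eq, normSq_sub_conj_eq]
  set d2 := (p.re - u₀.re) ^ 2 with hd2
  set y := p.im with hy
  set e := u₀.im with he
  have hK : 0 ≤ 2 * (m : ℝ) * y := by positivity
  have hN1 : 0 < d2 + (y - e) ^ 2 := by nlinarith [sq_nonneg (y - e), sq_nonneg e]
  have hN2 : 0 < d2 + (y + e) ^ 2 := by positivity
  have hN12 : d2 + (y - e) ^ 2 ≤ d2 + (y + e) ^ 2 := by nlinarith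
  have hA : 0 ≤ d2 + y ^ 2 - e ^ 2 := by nlinarith [sq_nonneg y]
  have hB : d2 - e ^ 2 ≤ d2 + y ^ 2 - e ^ 2 := by nlinarith [sq_nonneg y]
  rw [div_le_div_iff₀ (mul_pos hN1 hN2) (pow_pos hN2 2)]
  have h1 : (d2 - e ^ 2) * (d2 + (y - e) ^ 2) ≤ (d2 + y ^ 2 - e ^ 2) * (d2 + (y + e) ^ 2) :=
    mul_le_mul hB hN12 hN1.le hA
  have h2 : 2 * (m : ℝ) * y * ((d2 + (y + e) ^ 2) * ((d2 - e ^ 2) * (d2 + (y - e) ^ 2))) ≤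
      2 * (m : ℝ) * y * ((d2 + (y + e) ^ 2) * ((d2 + y ^ 2 - e ^ 2) * (d2 + (y + e) ^ 2))) :=
    mul_le_mul_of_nonneg_left (mul_le_mul_of_nonneg_left h1 hN2.le) hK
  nlinarith [h2]

/-- `pairTermCanopyBound_holds` — seam of the TiltedLandingLaw421 descent framework, part 04 (token-identical port of `Cruxes/TiltedLandingLaw421/Lines/law421birthS.lean`; no new mathematics). -/
theorem pairTermCanopyBound_holds : PairTermCanopyBound := by
  intro m p u hp hb
  unfold pairTerm
  rw [normSq_sub_eq, normSq_sub_conj_eq]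
  set d2 := (p.re - u.re) ^ 2 with hd2
  set y := p.im with hy
  set b := u.im with hb'
  have hbpos : 0 < b := by linarith
  have hd2nn : 0 ≤ d2 := by rw [hd2]; positivity
  have hK : 0 ≤ 2 * (m : ℝ) * y := by positivity
  have hN1 : b ^ 2 / 4 ≤ d2 + (y - b) ^ 2 := by nlinarith [sq_nonneg (y - b)]
  have hN1pos : 0 < d2 + (y - b) ^ 2 := by nlinarith [sq_nonneg b]
  have hN2 : b ^ 2 ≤ d2 + (y + b) ^ 2 := by nlinarith
  have hN2pos : 0 < d2 + (y + b) ^ 2 := by positivity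
  have hprod : b ^ 2 / 4 * b ^ 2 ≤ (d2 + (y - b) ^ 2) * (d2 + (y + b) ^ 2) :=
    mul_le_mul hN1 hN2 (by positivity) hN1pos.le
  rw [div_le_div_iff₀ (mul_pos hN1pos hN2pos) (pow_pos hbpos 2)]
  have h3 : 2 * (m : ℝ) * y * (b ^ 2 / 4 * b ^ 2) ≤ 2 * (m : ℝ) * y * ((d2 + (y - b) ^ 2) * (d2 + (y + b) ^ 2)) :=
    mul_le_mul_of_nonneg_left hprod hK
  have h4 : 0 ≤ 2 * (m : ℝ) * y * (d2 + y ^ 2) * b ^ 2 := by positivity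
  nlinarith [h3, h4]

end RhIdea5.G17.W07C9.Helpers
namespace RhIdea6.G18.W07C8.Law421BirthS.OKBoxLine
open Set Complex
open RhIdea6.G17.W07C7 RhIdea6.G17.W07C7.Rev6 RhIdea6.G18.W07C8.Law421BirthS
/-- `windowSig_OKBox` — seam of the TiltedLandingLaw421 descent framework, part 04 (token-identical port of `Cruxes/TiltedLandingLaw421/Lines/law421birthS.lean`; no new mathematics). -/
theorem windowSig_OKBox (hSign : OffJensenSignSig) (hDom : RhIdea5.G17.W07C9.Helpers.InDiscDominanceSig) :
    Split.WindowSig RhIdea5.G17.W07C9.Helpers.OKBox :=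
  RhIdea5.G17.W07C9.Helpers.windowSig_OKBox hSign hDom

/-- `law421T_of_OKBox` — seam of the TiltedLandingLaw421 descent framework, part 04 (token-identical port of `Cruxes/TiltedLandingLaw421/Lines/law421birthS.lean`; no new mathematics). -/
private theorem law421T_of_OKBox (hSign : OffJensenSignSig) (hDom : RhIdea5.G17.W07C9.Helpers.InDiscDominanceSig)
    (hB : Split.BudgetSig RhIdea5.G17.W07C9.Helpers.OKBox) (hHer : AnalyticHereditySig) :
    RhW07.Seam.Law421Statement :=
  law421T_of_budget_window RhIdea5.G17.W07C9.Helpers.OKBox hB (windowSig_OKBox hSign hDom) hHer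

end RhIdea6.G18.W07C8.Law421BirthS.OKBoxLine
open Complex Metric Set
open scoped ComplexConjugate
namespace RhIdea3.G21.W07C9.Landing
/-- `landing_real` — seam of the TiltedLandingLaw421 descent framework, part 04 (token-identical port of `Cruxes/TiltedLandingLaw421/Lines/law421birthS.lean`; no new mathematics). -/
theorem landing_real {h : ℂ → ℂ} {a ε ρ K K' : ℝ} (hh : Differentiable ℂ h)
    (hreal : ∀ x : ℝ, (h x).im = 0) (hρ : 0 < ρ)
    (h0 : ∀ z ∈ closedBall (a : ℂ) ρ, h z ≠ 0)
    (hK : ∀ z ∈ closedBall (a : ℂ) ρ, ‖deriv h z / h z‖ ≤ K)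
    (hK' : ∀ z ∈ closedBall (a : ℂ) ρ, ‖deriv (fun w ↦ deriv h w / h w) z‖ ≤ K')
    (hε : 0 ≤ ε) (hερ : ε ≤ ρ) (hL : K * ρ + K' * ρ ^ 2 < 1)
    {z : ℂ} (hz : z ∈ closedBall (a : ℂ) ρ)
    (hcrit : deriv (fun w : ℂ ↦ ((w - a) ^ 2 + (ε : ℂ) ^ 2) * h w) z = 0) : z.im = 0 := by
  classical
  set g : ℂ → ℂ := fun w ↦ ((w - a) ^ 2 + (ε : ℂ) ^ 2) * h w with hg
  set r : ℂ → ℂ := fun w ↦ deriv h w / h w with hr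
  set T : ℂ → ℂ := fun w ↦ -(((w - a) ^ 2 + (ε : ℂ) ^ 2) * r w) / 2 with hT

  have hgd : Differentiable ℂ g := fun w ↦ (RhW07.Law421.SuccessorCertificate.hasDerivAt_pairMulP hh a ε w).differentiableAt
  have hgreal : ∀ x : ℝ, (g x).im = 0 := by
    intro x
    have e : ((x : ℂ) - a) ^ 2 + (ε : ℂ) ^ 2 = (((x - a) ^ 2 + ε ^ 2 : ℝ) : ℂ) := by push_cast; ring
    show ((((x : ℂ) - a) ^ 2 + (ε : ℂ) ^ 2) * h x).im = 0
    rw [e, Complex.im_ofReal_mul, hreal x, mul_zero]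
  have hgd' : Differentiable ℂ (deriv g) := by
    have := Literature.Analysis.Complex.differentiable_iteratedDeriv_of_entire hgd 1
    simpa [iteratedDeriv_one] using this
  have hg'real : ∀ x : ℝ, (deriv g x).im = 0 := fun x ↦
    Literature.Analysis.Complex.im_deriv_ofReal hgd hgreal x

  have hfix : ∀ w ∈ closedBall (a : ℂ) ρ, deriv g w = 0 → w - a = T w := by
    intro w hw hw0
    have hd : deriv g w = 2 * (w - a) * h w + ((w - a) ^ 2 + (ε : ℂ) ^ 2) * deriv h w :=
      (RhW07.Law421.SuccessorCertificate.hasDerivAt_pairMulP hh a ε w).deriv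
    have hhw : h w ≠ 0 := h0 w hw
    rw [hd] at hw0
    show w - a = -(((w - a) ^ 2 + (ε : ℂ) ^ 2) * (deriv h w / h w)) / 2
    field_simp
    linear_combination hw0

  have hzc : conj z ∈ closedBall (a : ℂ) ρ := by
    rw [mem_closedBall, dist_eq_norm] at hz ⊢
    have : conj z - (a : ℂ) = conj (z - a) := by rw [map_sub, Complex.conj_ofReal]
    rwa [this, Complex.norm_conj]
  have hcrit' : deriv g (conj z) = 0 := by
    rw [Literature.Analysis.Complex.apply_conj_eq_conj hgd' hg'real z, hcrit, map_zero]

  have hdh : Differentiable ℂ (deriv h) := by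
    have := Literature.Analysis.Complex.differentiable_iteratedDeriv_of_entire hh 1
    simpa [iteratedDeriv_one] using this
  have hrd : ∀ w ∈ closedBall (a : ℂ) ρ, HasDerivAt r (deriv r w) w := fun w hw ↦
    ((hdh w).div (hh w) (h0 w hw)).hasDerivAt
  have hTd : ∀ w ∈ closedBall (a : ℂ) ρ,
      HasDerivAt T (-((2 * (w - a)) * r w + ((w - a) ^ 2 + (ε : ℂ) ^ 2) * deriv r w) / 2) w := by
    intro w hw
    exact (((RhW07.Law421.SuccessorCertificate.hasDerivAt_quadP a ε w).mul (hrd w hw)).neg).div_const 2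
  have hρ0 : 0 ≤ ρ := hρ.le
  have hTb : ∀ w ∈ closedBall (a : ℂ) ρ, ‖deriv T w‖ ≤ K * ρ + K' * ρ ^ 2 := by
    intro w hw
    rw [(hTd w hw).deriv]
    have hwa : ‖w - a‖ ≤ ρ := by rwa [mem_closedBall, dist_eq_norm] at hw
    have hq : ‖(w - a) ^ 2 + (ε : ℂ) ^ 2‖ ≤ 2 * ρ ^ 2 := by
      calc ‖(w - a) ^ 2 + (ε : ℂ) ^ 2‖ ≤ ‖(w - a) ^ 2‖ + ‖(ε : ℂ) ^ 2‖ := norm_add_le _ _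
        _ = ‖w - a‖ ^ 2 + ε ^ 2 := by
            rw [norm_pow, norm_pow, Complex.norm_real, Real.norm_eq_abs, sq_abs]
        _ ≤ ρ ^ 2 + ρ ^ 2 := by gcongr
        _ = 2 * ρ ^ 2 := by ring
    have hrw : ‖r w‖ ≤ K := hK w hw
    have hr'w : ‖deriv r w‖ ≤ K' := hK' w hw
    calc ‖-((2 * (w - a)) * r w + ((w - a) ^ 2 + (ε : ℂ) ^ 2) * deriv r w) / 2‖
        = ‖(2 * (w - a)) * r w + ((w - a) ^ 2 + (ε : ℂ) ^ 2) * deriv r w‖ / 2 := by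
          rw [norm_div, norm_neg]
          norm_num
      _ ≤ (‖(2 * (w - a)) * r w‖ + ‖((w - a) ^ 2 + (ε : ℂ) ^ 2) * deriv r w‖) / 2 := by
          gcongr
          exact norm_add_le _ _
      _ = (2 * ‖w - a‖ * ‖r w‖ + ‖(w - a) ^ 2 + (ε : ℂ) ^ 2‖ * ‖deriv r w‖) / 2 := by
          rw [norm_mul, norm_mul, norm_mul]
          norm_num
      _ ≤ (2 * ρ * K + (2 * ρ ^ 2) * K') / 2 := by gcongr
      _ = K * ρ + K' * ρ ^ 2 := by ring
  have hLip : ‖T (conj z) - T z‖ ≤ (K * ρ + K' * ρ ^ 2) * ‖conj z - z‖ :=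
    (convex_closedBall (a : ℂ) ρ).norm_image_sub_le_of_norm_deriv_le
      (fun w hw ↦ (hTd w hw).differentiableAt) hTb hz hzc

  have e1 : z - a = T z := hfix z hz hcrit
  have e2 : conj z - a = T (conj z) := hfix (conj z) hzc hcrit'
  have e3 : conj z - z = T (conj z) - T z := by linear_combination e2 - e1
  have hn : ‖conj z - z‖ ≤ (K * ρ + K' * ρ ^ 2) * ‖conj z - z‖ := by
    calc ‖conj z - z‖ = ‖T (conj z) - T z‖ := by rw [e3]
      _ ≤ (K * ρ + K' * ρ ^ 2) * ‖conj z - z‖ := hLip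
  have h0n : ‖conj z - z‖ = 0 := by
    nlinarith [norm_nonneg (conj z - z)]
  have hzz : conj z = z := by
    rwa [norm_eq_zero, sub_eq_zero] at h0n
  exact Complex.conj_eq_iff_im.1 hzz

end RhIdea3.G21.W07C9.Landing
namespace RhW07.C11.DescentSplit.C3
open Set Complex Metric
open Summit.RiemannHypothesis.RiemannHypothesis.Theorems.Splittings.JensenWindow (LocalA)
open RhIdea6.G17.W07C7 RhIdea6.G17.W07C7.Rev6 RhIdea6.G18.W07C8.Law421BirthS
/-- `PairFactor` — seam of the TiltedLandingLaw421 descent framework, part 04 (token-identical port of `Cruxes/TiltedLandingLaw421/Lines/law421birthS.lean`; no new mathematics). -/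
def PairFactor (g h : ℂ → ℂ) (a ε : ℝ) : Prop :=
  Differentiable ℂ h ∧ (∀ x : ℝ, (h x).im = 0) ∧ ∀ z : ℂ, g z = ((z - a) ^ 2 + (ε : ℂ) ^ 2) * h z

/-- `LandingReady` — seam of the TiltedLandingLaw421 descent framework, part 04 (token-identical port of `Cruxes/TiltedLandingLaw421/Lines/law421birthS.lean`; no new mathematics). -/
def LandingReady (h : ℂ → ℂ) (a ρ K K' : ℝ) : Prop :=
  0 < ρ ∧ (∀ z ∈ closedBall (a : ℂ) ρ, h z ≠ 0) ∧ (∀ z ∈ closedBall (a : ℂ) ρ, ‖deriv h z / h z‖ ≤ K) ∧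
    (∀ z ∈ closedBall (a : ℂ) ρ, ‖deriv (fun w ↦ deriv h w / h w) z‖ ≤ K') ∧ K * ρ + K' * ρ ^ 2 < 1

/-- `JensenClearBox` — seam of the TiltedLandingLaw421 descent framework, part 04 (token-identical port of `Cruxes/TiltedLandingLaw421/Lines/law421birthS.lean`; no new mathematics). -/
def JensenClearBox (g : ℂ → ℂ) (α β H a ρ : ℝ) : Prop :=
  ∀ z ∈ Ioo α β ×ℂ Ioo (-H) H, deriv g z = 0 → z.im ≠ 0 → z ∈ closedBall (a : ℂ) ρ

/-- `BoxDominated` — seam of the TiltedLandingLaw421 descent framework, part 04 (token-identical port of `Cruxes/TiltedLandingLaw421/Lines/law421birthS.lean`; no new mathematics). -/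
def BoxDominated (g : ℂ → ℂ) (α β H : ℝ) : Prop :=
  α < β ∧ 0 < H ∧ g α ≠ 0 ∧ g β ≠ 0 ∧ deriv g α ≠ 0 ∧ deriv g β ≠ 0 ∧
    (∀ x ∈ Icc α β, (deriv g ((x : ℂ) + (H : ℂ) * I) / g ((x : ℂ) + (H : ℂ) * I)).im < 0) ∧
    (∀ y ∈ Ioc (0 : ℝ) H, (deriv g ((α : ℂ) + (y : ℂ) * I) / g ((α : ℂ) + (y : ℂ) * I)).im < 0) ∧
    (∀ y ∈ Ioc (0 : ℝ) H, (deriv g ((β : ℂ) + (y : ℂ) * I) / g ((β : ℂ) + (y : ℂ) * I)).im < 0) ∧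
    (∃ ρ ∈ Ioo α β ×ℂ Ioo (-H) H, g ρ = 0 ∧ ρ.im ≠ 0)

/-- `PLand` — seam of the TiltedLandingLaw421 descent framework, part 04 (token-identical port of `Cruxes/TiltedLandingLaw421/Lines/law421birthS.lean`; no new mathematics). -/
def PLand : Prop := ∀ (g h : ℂ → ℂ) (a ε α β H ρ K K' : ℝ),
  PairFactor g h a ε → 0 ≤ ε → ε ≤ ρ → LandingReady h a ρ K K' → JensenClearBox g α β H a ρ →
    BoxDominated g α β H → SignWindow g α β H

/-- `pLand_holds` — seam of the TiltedLandingLaw421 descent framework, part 04 (token-identical port of `Cruxes/TiltedLandingLaw421/Lines/law421birthS.lean`; no new mathematics). -/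
theorem pLand_holds : PLand := by
  intro g h a ε α β H ρ K K' hPF hε hερ hL hJ hD
  obtain ⟨hh, hreal, hfac⟩ := hPF
  obtain ⟨hρ, h0, hK, hK', hlt⟩ := hL
  obtain ⟨hab, hH, hgα, hgβ, hdα, hdβ, htop, hleft, hright, hz⟩ := hD
  refine ⟨hab, hH, hgα, hgβ, hdα, hdβ, htop, hleft, hright, ?_, hz⟩
  intro z hzbox hcrit
  by_contra him
  have hzball := hJ z hzbox hcrit him
  have hg : g = fun w : ℂ ↦ ((w - a) ^ 2 + (ε : ℂ) ^ 2) * h w := funext hfac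
  have hcrit' : deriv (fun w : ℂ ↦ ((w - a) ^ 2 + (ε : ℂ) ^ 2) * h w) z = 0 := by rw [← hg]; exact hcrit
  exact him (RhIdea3.G21.W07C9.Landing.landing_real hh hreal hρ h0 hK hK' hε hερ hlt hzball hcrit')

/-- `PDrop` — seam of the TiltedLandingLaw421 descent framework, part 04 (token-identical port of `Cruxes/TiltedLandingLaw421/Lines/law421birthS.lean`; no new mathematics). -/
def PDrop : Prop := ∃ c₀ : ℝ, 0 < c₀ ∧ ∀ (g h : ℂ → ℂ) (a ε κ θ : ℝ),
  PairFactor g h a ε → 0 < ε → 0 < κ → 0 ≤ θ → 2 ≤ κ * ε → θ * ε ≤ c₀ →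
    (∀ z ∈ closedBall (a : ℂ) (2 * ε), h z ≠ 0 ∧ ‖deriv h z / h z + κ‖ ≤ θ) →
      ∃ z₁ : ℂ, deriv g z₁ = 0 ∧ ‖z₁ - a‖ ≤ 2 * ε ∧ 0 < z₁.im ∧ z₁.im ^ 2 ≤ ε ^ 2 - 1 / (2 * κ ^ 2)

/-- `PDropC` — seam of the TiltedLandingLaw421 descent framework, part 04 (token-identical port of `Cruxes/TiltedLandingLaw421/Lines/law421birthS.lean`; no new mathematics). -/
def PDropC : Prop := ∃ C₀ c₀ : ℝ, 0 < C₀ ∧ 0 < c₀ ∧ ∀ (g h : ℂ → ℂ) (a ε θ : ℝ) (c : ℂ),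
  PairFactor g h a ε → 0 < ε → 0 ≤ θ → 2 ≤ ‖c‖ * ε → θ ≤ c₀ * ‖c‖ →
    (∀ z ∈ closedBall (a : ℂ) (2 * ε), h z ≠ 0 ∧ ‖deriv h z / h z - c‖ ≤ θ) →
      ∃ z₁ : ℂ, deriv g z₁ = 0 ∧ ‖z₁ - ((a : ℂ) + (ε : ℂ) * I - 1 / c)‖ ≤ 1 / (‖c‖ ^ 2 * ε) + C₀ * θ / ‖c‖ ^ 2

/-- `PairAt` — seam of the TiltedLandingLaw421 descent framework, part 04 (token-identical port of `Cruxes/TiltedLandingLaw421/Lines/law421birthS.lean`; no new mathematics). -/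
def PairAt (f : ℂ → ℂ) (j : ℕ) (x₀ R hmax : ℝ) (u : ℂ) : Prop :=
  iteratedDeriv j f u = 0 ∧ 0 < u.im ∧ |u.re - x₀| ≤ ((j : ℝ) + 2) * R / 2 ∧ u.im ≤ hmax ∧
    ∀ v : ℂ, iteratedDeriv j f v = 0 → v.im ≠ 0 → |v.re - u.re| < u.im → u.im ≤ |v.im|

/-- `ReadyAt` — seam of the TiltedLandingLaw421 descent framework, part 04 (token-identical port of `Cruxes/TiltedLandingLaw421/Lines/law421birthS.lean`; no new mathematics). -/
def ReadyAt (g : ℂ → ℂ) (u : ℂ) : Prop :=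
  ∃ (h : ℂ → ℂ) (ρ K K' : ℝ), PairFactor g h u.re u.im ∧ u.im ≤ ρ ∧ LandingReady h u.re ρ K K'

/-- `FrozenDownAt` — seam of the TiltedLandingLaw421 descent framework, part 04 (token-identical port of `Cruxes/TiltedLandingLaw421/Lines/law421birthS.lean`; no new mathematics). -/
def FrozenDownAt (c₀ d : ℝ) (g : ℂ → ℂ) (u : ℂ) : Prop :=
  ∃ (h : ℂ → ℂ) (c : ℂ) (θ : ℝ), PairFactor g h u.re u.im ∧ 0 ≤ θ ∧ 2 ≤ ‖c‖ * u.im ∧ θ ≤ c₀ * ‖c‖ ∧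
    (-1 / c).im ≤ -d ∧ ∀ z ∈ closedBall (u.re : ℂ) (2 * u.im), h z ≠ 0 ∧ ‖deriv h z / h z - c‖ ≤ θ

/-- `PSurplus` — seam of the TiltedLandingLaw421 descent framework, part 04 (token-identical port of `Cruxes/TiltedLandingLaw421/Lines/law421birthS.lean`; no new mathematics). -/
def PSurplus (c₀ μ : ℝ) : Prop := ∀ (η : ℝ) (f : ℂ → ℂ) (x₀ s hmax R Hs : ℝ) (B : ℕ),
  EngineHyps5 2 η f x₀ s hmax R Hs B →
    ∃ E : Finset ℕ, (E.card : ℝ) ≤ (Hs / s) ^ 2 + B ∧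
      ∀ (j : ℕ) (u : ℂ), j ∉ E → iteratedDeriv j f ≠ 0 → PairAt f j x₀ R hmax u →
        ReadyAt (iteratedDeriv j f) u ∨ FrozenDownAt c₀ (μ * s) (iteratedDeriv j f) u

/-- `PHeld` — seam of the TiltedLandingLaw421 descent framework, part 04 (token-identical port of `Cruxes/TiltedLandingLaw421/Lines/law421birthS.lean`; no new mathematics). -/
abbrev PHeld (c₀ μ : ℝ) : Prop := PSurplus c₀ μ

/-- `ClearBoxReadyAt` — seam of the TiltedLandingLaw421 descent framework, part 04 (token-identical port of `Cruxes/TiltedLandingLaw421/Lines/law421birthS.lean`; no new mathematics). -/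
def ClearBoxReadyAt (W : ℝ) (g : ℂ → ℂ) (u : ℂ) : Prop :=
  ∃ (h : ℂ → ℂ) (ρ K K' α β H : ℝ), PairFactor g h u.re u.im ∧ u.im ≤ ρ ∧ LandingReady h u.re ρ K K' ∧
    u.re - W ≤ α ∧ β ≤ u.re + W ∧ JensenClearBox g α β H u.re ρ ∧ BoxDominated g α β H

/-- `readyAt_of_clearBoxReady` — seam of the TiltedLandingLaw421 descent framework, part 04 (token-identical port of `Cruxes/TiltedLandingLaw421/Lines/law421birthS.lean`; no new mathematics). -/
theorem readyAt_of_clearBoxReady {W : ℝ} {g : ℂ → ℂ} {u : ℂ} (hu : ClearBoxReadyAt W g u) : ReadyAt g u := by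
  obtain ⟨h, ρ, K, K', α, β, H, hPF, hρ, hL, -, -, -, -⟩ := hu
  exact ⟨h, ρ, K, K', hPF, hρ, hL⟩

/-- `signWindow_of_clearBoxReady` — seam of the TiltedLandingLaw421 descent framework, part 04 (token-identical port of `Cruxes/TiltedLandingLaw421/Lines/law421birthS.lean`; no new mathematics). -/
theorem signWindow_of_clearBoxReady {W : ℝ} {g : ℂ → ℂ} {u : ℂ} (hu0 : 0 ≤ u.im) (hu : ClearBoxReadyAt W g u) :
    ∃ α β H : ℝ, u.re - W ≤ α ∧ β ≤ u.re + W ∧ SignWindow g α β H := by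
  obtain ⟨h, ρ, K, K', α, β, H, hPF, hρ, hL, hα, hβ, hJ, hD⟩ := hu
  exact ⟨α, β, H, hα, hβ, pLand_holds g h u.re u.im α β H ρ K K' hPF hu0 hρ hL hJ hD⟩

/-- `PSurplusBox` — seam of the TiltedLandingLaw421 descent framework, part 04 (token-identical port of `Cruxes/TiltedLandingLaw421/Lines/law421birthS.lean`; no new mathematics). -/
def PSurplusBox (c₀ μ : ℝ) : Prop := ∀ (η : ℝ) (f : ℂ → ℂ) (x₀ s hmax R Hs : ℝ) (B : ℕ),
  EngineHyps5 2 η f x₀ s hmax R Hs B →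
    ∃ E : Finset ℕ, (E.card : ℝ) ≤ (Hs / s) ^ 2 + B ∧
      ∀ (j : ℕ) (u : ℂ), j ∉ E → iteratedDeriv j f ≠ 0 → PairAt f j x₀ R hmax u →
        ClearBoxReadyAt (R / 2) (iteratedDeriv j f) u ∨ FrozenDownAt c₀ (μ * s) (iteratedDeriv j f) u

/-- `pSurplus_of_box` — seam of the TiltedLandingLaw421 descent framework, part 04 (token-identical port of `Cruxes/TiltedLandingLaw421/Lines/law421birthS.lean`; no new mathematics). -/
theorem pSurplus_of_box {c₀ μ : ℝ} (hB : PSurplusBox c₀ μ) : PSurplus c₀ μ := by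
  intro η f x₀ s hmax R Hs B hE
  obtain ⟨E, hcard, hEj⟩ := hB η f x₀ s hmax R Hs B hE
  refine ⟨E, hcard, fun j u hj hne hP ↦ ?_⟩
  rcases hEj j u hj hne hP with hR | hF
  · exact Or.inl (readyAt_of_clearBoxReady hR)
  · exact Or.inr hF

/-- `descent_exit_of_clearBoxReady` — seam of the TiltedLandingLaw421 descent framework, part 04 (token-identical port of `Cruxes/TiltedLandingLaw421/Lines/law421birthS.lean`; no new mathematics). -/
theorem descent_exit_of_clearBoxReady {f : ℂ → ℂ} {j : ℕ} {x₀ R hmax : ℝ} {u : ℂ}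
    (hP : PairAt f j x₀ R hmax u) (hu : ClearBoxReadyAt (R / 2) (iteratedDeriv j f) u) :
    ∃ α β H : ℝ, x₀ - ((j : ℝ) + 3) * R / 2 ≤ α ∧ β ≤ x₀ + ((j : ℝ) + 3) * R / 2 ∧
      SignWindow (iteratedDeriv j f) α β H := by
  obtain ⟨-, hpos, hre, -, -⟩ := hP
  obtain ⟨α, β, H, hα, hβ, hW⟩ := signWindow_of_clearBoxReady hpos.le hu
  have h1 := (abs_le.1 hre).1
  have h2 := (abs_le.1 hre).2
  refine ⟨α, β, H, by linarith, by linarith, hW⟩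

end RhW07.C11.DescentSplit.C3
namespace RhIdea6.G18.W07C8.Law421BirthS
open Set Complex
open Summit.RiemannHypothesis.RiemannHypothesis.Theorems.Splittings.JensenWindow (LocalA)
open Summit.RiemannHypothesis.RiemannHypothesis.Theorems.Splittings.EarlyAppointmentsLocalFourierPolya
open RhIdea6.G17.W07C7 RhIdea6.G17.W07C7.Rev6
/-- `DescentSigS'` — seam of the TiltedLandingLaw421 descent framework, part 04 (token-identical port of `Cruxes/TiltedLandingLaw421/Lines/law421birthS.lean`; no new mathematics). -/
def DescentSigS' : Prop := ∀ (η : ℝ) (f : ℂ → ℂ) (x₀ s hmax R Hs : ℝ) (B : ℕ),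
  EngineHyps5 2 η f x₀ s hmax R Hs B →
    ∃ (j : ℕ) (α β H : ℝ), (j : ℝ) ≤ 4 * hmax / s + (Hs / s) ^ 2 + B + 1 ∧
      x₀ - (j + 3) * R / 2 ≤ α ∧ β ≤ x₀ + (j + 3) * R / 2 ∧
      iteratedDeriv j f ≠ 0 ∧ SignWindow (iteratedDeriv j f) α β H

/-- `descentSigS'_of_descentSigS` — seam of the TiltedLandingLaw421 descent framework, part 04 (token-identical port of `Cruxes/TiltedLandingLaw421/Lines/law421birthS.lean`; no new mathematics). -/
theorem descentSigS'_of_descentSigS (h : DescentSigS) : DescentSigS' := by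
  intro η f x₀ s hmax R Hs B hE
  obtain ⟨j, α, β, H, hj, hα, hβ, hnz, hW⟩ := h η f x₀ s hmax R Hs B hE
  exact ⟨j, α, β, H, by linarith, hα, hβ, hnz, hW⟩


end RhIdea6.G18.W07C8.Law421BirthS
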